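import Literature.NumberTheory.Sieve.FriedlanderIwaniecPrimesLemma51
import Literature.NumberTheory.QuadraticFields.GaussianPrimary
import HarnessLib

/-!
# Friedlander–Iwaniec, *The polynomial `X² + Y⁴` captures its primes*, §5 (5.21)–(5.22): the pairs `(z₁, z₂) ≠ 1`

Family `parity`, statement parity.S17. Source: J. Friedlander, H. Iwaniec, Ann. of Math. (2) 148
(1998), 945–1040 [FriedlanderIwaniecAnnals1998], §5, between (5.21) and (5.22): "Here we want to
insert the condition `(z₁, z₂) = 1` … We shall prove that the difference `𝒟̃(M, N)` between these
two sums satisfies `𝒟̃(M, N) ≪ τ² (M^{3/4} N^{3/4} + P⁻¹ M^{1/2} N^{3/2}) (log MN)^{516}`. Indeed,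
denoting Gaussian primes by `π` we find that `𝒟̃(M, N)` is bounded by
`Σ_{P < |π|² ≤ N} Σ_{M < |w|² ≤ 2M} Σ Σ_{N/|π|² < |z₁|², |z₂|² ≤ 2N/|π|²} |β_{πz₁} β_{πz₂}|
𝔷(Re w̄ π z₁) 𝔷(Re w̄ π z₂) ≪ τ² D(M P₁, N P₁⁻¹) (log MN)²` for some `P₁` with `P < P₁ ≤ N`. The
result now follows from Lemma 5.1."

This file PROVES the combinatorial heart of that sentence, in the language of the crude Lemma 5.1
of `FriedlanderIwaniecPrimesLemma51`: for a finite set `Z` of Gaussian integers `z` with `|z|² ≤ N₀`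
odd, squarefree, primitive and free of prime factors `< P₀`, and the `w` with `1 ≤ |w|² ≤ M₀`,

  `Σ_w Σ Σ_{z₁, z₂ ∈ Z, (z₁, z₂) ≠ 1} 𝔷(Re w̄ z₁) 𝔷(Re w̄ z₂)
     ≤ Σ_{j : 2^j ∈ [P₀/2, N₀]} 2 (log₂(2^{j+1} M₀) + 1) · D(⌊√(2^{j+1} M₀)⌋ + 1, ⌊√(N₀/2^j)⌋ + 1)`

(`sum_noncoprime_le`), `D` = `lemma51Count`. The steps: a common divisor of a non-coprime pair may
be taken to be a primary Gaussian prime `π` of prime norm `p`, `P₀ ≤ p ≤ N₀`, `p ∣ |z₁|²`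
(`exists_primary_prime_dvd`); `z_i = π y_i` with `y_i` primitive, `|y_i|² ≤ N₀/p`, and
`Re w̄ π y = Re (π̄ w)‾ y` (`star_mul_mul_eq`); grouping `p` dyadically, the map `(π, w) ↦ π̄ w` has
fibres of size `≤ 2 ω(|π̄ w|²) ≤ 2 log₂ |π̄ w|²` (`#primaryNormEq p ≤ 2`,
`card_primaryNormEq_le_two`), which is the source's "for some `P₁`" multiplicity count.

## References

* J. Friedlander, H. Iwaniec, Ann. of Math. (2) 148 (1998), 945–1040, §5 (5.21)–(5.22).
  [FriedlanderIwaniecAnnals1998]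

## Tree

`lemma51Count`, `intBox`, `primBox`, `IsPrimVec`, `reConj` (`…Lemma51`); `sqPairs`, `toGauss`,
`ofGauss`, `fiZeta` (`…GaussianParam`); `primaryNormEq`, `primary`, `isPrimary_primary`,
`associated_primary`, `norm_primary`, `norm_dvd_norm`, `self_dvd_norm`, `norm_emod_two`,
`exists_isPrimary_norm_eq`, `primaryNormEq_pow_of_mod_four_eq_one`,
`primaryNormEq_pow_of_mod_four_eq_three`, `primaryNormEq_eq_empty_of_even`
(`QuadraticFields.GaussianPrimary`). Mathlib: `EuclideanDomain.isCoprime_of_dvd`,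
`WfDvdMonoid.exists_irreducible_factor`, `Prime.exists_mem_finset_dvd`, `Zsqrtd.intCast_dvd`.
-/

noncomputable section

open Finset
open Literature.NumberTheory.QuadraticFields.GaussianPrimary

namespace Literature.NumberTheory.Sieve.FriedlanderIwaniecPrimes

/-! ### Coprimality in `ℤ[i]` -/

/-- `(z₁, z₂) = 1` in `ℤ[i]`, in the decidable form "the Euclidean gcd has norm `1`".
[cite: FriedlanderIwaniecAnnals1998, (5.21)-(5.26)] -/
def GaussCoprime (z₁ z₂ : GaussianInt) : Prop := (EuclideanDomain.gcd z₁ z₂).norm.natAbs = 1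

/-- `GaussCoprime` is decidable. [folklore] -/
instance (z₁ z₂ : GaussianInt) : Decidable (GaussCoprime z₁ z₂) := inferInstanceAs (Decidable (_ = _))

/-- `GaussCoprime z₁ z₂ ↔ IsCoprime z₁ z₂`. [folklore] -/
theorem gaussCoprime_iff (z₁ z₂ : GaussianInt) : GaussCoprime z₁ z₂ ↔ IsCoprime z₁ z₂ := by
  rw [GaussCoprime, Zsqrtd.norm_eq_one_iff, EuclideanDomain.gcd_isUnit_iff]

/-! ### A common primary prime of a non-coprime pair -/

/-- The norm of a Gaussian integer as a natural number. [folklore] -/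
theorem norm_eq_natAbs (z : GaussianInt) : z.norm = (z.norm.natAbs : ℤ) :=
  (Int.natAbs_of_nonneg (Zsqrtd.norm_nonneg (by norm_num) z)).symm

/-- **A non-coprime pair has a common primary prime divisor of prime norm.** If `z₁ ≠ 0` has odd
squarefree norm all of whose prime factors are `≥ P₀`, and `(z₁, z₂) ≠ 1`, then there are a prime
`p ≥ P₀` dividing `|z₁|²` and a primary `π` with `|π|² = p`, `π ∣ z₁`, `π ∣ z₂` (the Gaussian primes
`π` of the source, "`P < |π|² ≤ N`"). [cite: FriedlanderIwaniecAnnals1998, §5, proof of (5.22)] -/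
theorem exists_primary_prime_dvd {z₁ z₂ : GaussianInt} (hz₁ : z₁ ≠ 0)
    (hodd : z₁.norm.natAbs % 2 = 1) (hsq : Squarefree z₁.norm.natAbs) {P₀ : ℕ}
    (hP : ∀ p ∈ z₁.norm.natAbs.primeFactors, P₀ ≤ p) (hnc : ¬ IsCoprime z₁ z₂) :
    ∃ p : ℕ, p.Prime ∧ P₀ ≤ p ∧ p ∣ z₁.norm.natAbs ∧
      ∃ pr ∈ primaryNormEq p, pr ∣ z₁ ∧ pr ∣ z₂ := by
  -- a common non-unit divisor
  have hδ : ∃ δ : GaussianInt, ¬ IsUnit δ ∧ δ ≠ 0 ∧ δ ∣ z₁ ∧ δ ∣ z₂ := by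
    by_contra hcon
    push Not at hcon
    exact hnc (EuclideanDomain.isCoprime_of_dvd (fun h => hz₁ h.1)
      fun δ hδu hδ0 h1 h2 => hcon δ hδu hδ0 h1 h2)
  obtain ⟨δ, hδu, hδ0, hδ1, hδ2⟩ := hδ
  -- a prime factor of it
  obtain ⟨ρ, hρirr, hρδ⟩ := WfDvdMonoid.exists_irreducible_factor hδu hδ0
  have hρ : Prime ρ := irreducible_iff_prime.mp hρirr
  have hρ1 : ρ ∣ z₁ := hρδ.trans hδ1
  have hρ2 : ρ ∣ z₂ := hρδ.trans hδ2
  -- ρ divides the norm of z₁, a product of distinct rational primes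
  set n : ℕ := z₁.norm.natAbs with hn
  have hn0 : n ≠ 0 := by
    rw [hn, Int.natAbs_ne_zero]
    exact (Zsqrtd.norm_eq_zero_iff (by norm_num) z₁).not.mpr hz₁
  have hzn : z₁ ∣ (n : GaussianInt) := by
    have h := self_dvd_norm z₁
    rwa [norm_eq_natAbs z₁, Int.cast_natCast] at h
  have hprod : (n : GaussianInt) = ∏ p ∈ n.primeFactors, (p : GaussianInt) := by
    rw [← Nat.cast_prod, Nat.prod_primeFactors_of_squarefree hsq]
  have hρn : ρ ∣ ∏ p ∈ n.primeFactors, (p : GaussianInt) := hprod ▸ hρ1.trans hzn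
  obtain ⟨p, hp, hρp⟩ := hρ.exists_mem_finset_dvd hρn
  have hpp : p.Prime := Nat.prime_of_mem_primeFactors hp
  have hpn : p ∣ n := Nat.dvd_of_mem_primeFactors hp
  -- the norm of ρ is p
  have hNρ_dvd : ρ.norm.natAbs ∣ p ^ 2 := by
    have h := norm_dvd_norm hρp
    rw [Zsqrtd.norm_natCast] at h
    have : (ρ.norm.natAbs : ℤ) ∣ ((p ^ 2 : ℕ) : ℤ) := by
      rw [← norm_eq_natAbs]; push_cast; rw [sq]; exact h
    exact_mod_cast this
  have hNρ1 : ρ.norm.natAbs ≠ 1 := fun h => hρ.not_unit (Zsqrtd.norm_eq_one_iff.mp h)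
  have hNρp : ρ.norm.natAbs = p := by
    obtain ⟨i, hi, hieq⟩ := (Nat.dvd_prime_pow hpp).mp hNρ_dvd
    interval_cases i
    · rw [pow_zero] at hieq; exact absurd hieq hNρ1
    · rw [pow_one] at hieq; exact hieq
    · -- i = 2: p² ∣ n, contradicting squarefreeness
      exfalso
      have hρn' : ρ.norm.natAbs ∣ n := by
        have := norm_dvd_norm hρ1
        exact Int.natAbs_dvd_natAbs.mpr this
      rw [hieq, sq] at hρn'
      exact hpp.not_isUnit (hsq p hρn')
  -- P₀ ≤ p
  have hPp : P₀ ≤ p := hP p hp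
  -- pass to the primary associate
  have hpar : (ρ.re + ρ.im) % 2 = 1 := by
    rw [← norm_emod_two, norm_eq_natAbs ρ, hNρp]
    have hpodd : p % 2 = 1 := by
      have h2 : ¬ 2 ∣ n := by intro h2; omega
      have : ¬ 2 ∣ p := fun h => h2 (h.trans hpn)
      omega
    exact_mod_cast hpodd
  refine ⟨p, hpp, hPp, hpn, primary ρ, ?_, ?_, ?_⟩
  · rw [mem_primaryNormEq]
    refine ⟨?_, isPrimary_primary hpar⟩
    rw [norm_primary hpar, norm_eq_natAbs ρ, hNρp]
  · exact (associated_primary hpar).dvd_iff_dvd_left.mp hρ1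
  · exact (associated_primary hpar).dvd_iff_dvd_left.mp hρ2

/-- **At most two primary elements of prime norm `p`** (`π`, `π̄` for `p ≡ 1 (mod 4)`; none
otherwise). [folklore] -/
theorem card_primaryNormEq_le_two {p : ℕ} (hp : p.Prime) : #(primaryNormEq p) ≤ 2 := by
  haveI := Fact.mk hp
  have h4 : p = 2 ∨ p % 4 = 1 ∨ p % 4 = 3 := by
    rcases hp.eq_two_or_odd with h | h
    · exact Or.inl h
    · right; omega
  rcases h4 with rfl | h1 | h3
  · rw [primaryNormEq_eq_empty_of_even (dvd_refl 2)]; simp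
  · obtain ⟨pr, hpr, hprn⟩ := exists_isPrimary_norm_eq h1
    have := primaryNormEq_pow_of_mod_four_eq_one hp hpr hprn 1
    rw [pow_one] at this
    rw [this]
    exact card_image_le.trans (by rw [card_range])
  · have := (primaryNormEq_pow_of_mod_four_eq_three h3 0).2
    rw [mul_zero, zero_add, pow_one] at this
    rw [this]; simp

/-! ### Reindexing `z = π y`, `w' = π̄ w` -/

/-- `w̄ (π y) = (π̄ w)‾ y`. [cite: FriedlanderIwaniecAnnals1998, §5, proof of (5.22)] -/
theorem star_mul_mul_eq (w pr y : GaussianInt) : star w * (pr * y) = star (star pr * w) * y := by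
  rw [star_mul, star_star]; ring

/-- `Re(w̄ y) = u r + v s` in coordinates: `reConj (ofGauss w) (ofGauss y) = Re(w̄ y)`. [folklore] -/
theorem reConj_ofGauss (w y : GaussianInt) : reConj (ofGauss w) (ofGauss y) = (star w * y).re := by
  simp only [reConj, ofGauss, Zsqrtd.re_mul, Zsqrtd.re_star, Zsqrtd.im_star]
  ring

/-- If `z = π y` and `z` is primitive then `y` is primitive. [folklore] -/
theorem isPrimVec_ofGauss_of_eq_mul {pr y z : GaussianInt} (h : pr * y = z)
    (hz : Int.gcd z.re z.im = 1) : IsPrimVec (ofGauss y) := by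
  unfold IsPrimVec ofGauss
  simp only
  set g : ℕ := Int.gcd y.re y.im with hg
  have hgy : ((g : ℤ) : GaussianInt) ∣ y :=
    (Zsqrtd.intCast_dvd g y).mpr ⟨Int.gcd_dvd_left _ _, Int.gcd_dvd_right _ _⟩
  have hgz : ((g : ℤ) : GaussianInt) ∣ z := h ▸ hgy.mul_left pr
  obtain ⟨h1, h2⟩ := (Zsqrtd.intCast_dvd g z).mp hgz
  have hg1 : (g : ℤ) ∣ (Int.gcd z.re z.im : ℤ) := Int.dvd_coe_gcd h1 h2
  rw [hz] at hg1
  have : g ∣ 1 := by exact_mod_cast hg1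
  exact Nat.dvd_one.mp this

/-- The box radius for the `y`: `⌊√(N₀/2^j)⌋ + 1`. [folklore] -/
def radN (N₀ j : ℕ) : ℕ := Nat.sqrt (N₀ / 2 ^ j) + 1

/-- The box radius for the `w' = π̄ w`: `⌊√(2^{j+1} M₀)⌋ + 1`. [folklore] -/
def radM (M₀ j : ℕ) : ℕ := Nat.sqrt (2 ^ (j + 1) * M₀) + 1

/-- Coordinates are bounded by the square root of the norm. [folklore] -/
theorem natAbs_re_le_sqrt {y : GaussianInt} {K : ℕ} (h : y.norm.natAbs ≤ K) :
    y.re.natAbs ≤ Nat.sqrt K ∧ y.im.natAbs ≤ Nat.sqrt K := by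
  have hn : y.norm = y.re ^ 2 + y.im ^ 2 := by rw [Zsqrtd.norm_def]; ring
  have hK : y.re.natAbs ^ 2 + y.im.natAbs ^ 2 ≤ K := by
    have : ((y.re.natAbs ^ 2 + y.im.natAbs ^ 2 : ℕ) : ℤ) = y.norm := by
      push_cast; rw [sq_abs, sq_abs, hn]
    have h2 : ((y.re.natAbs ^ 2 + y.im.natAbs ^ 2 : ℕ) : ℤ) ≤ (K : ℤ) := by
      rw [this, norm_eq_natAbs y]; exact_mod_cast h
    exact_mod_cast h2
  constructor
  · rw [Nat.le_sqrt']; omega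
  · rw [Nat.le_sqrt']; omega

/-- Membership in `intBox` from coordinate bounds. [folklore] -/
theorem ofGauss_mem_intBox {y : GaussianInt} {R : ℕ} (h1 : y.re.natAbs ≤ R) (h2 : y.im.natAbs ≤ R) :
    ofGauss y ∈ intBox R := by
  rw [mem_intBox]
  simp only [ofGauss]
  constructor <;> constructor <;> omega

/-- **The `y = z/π` lie in `primBox (radN N₀ j)`** when `|z|² ≤ N₀`, `z` primitive, `|π|² = p ≥ 2^j`.
[cite: FriedlanderIwaniecAnnals1998, §5, proof of (5.22)] -/
theorem ofGauss_div_mem_primBox {pr z : GaussianInt} {p N₀ j : ℕ} (hprn : pr.norm = p) (hp : 2 ^ j ≤ p)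
    (hdvd : pr ∣ z) (hzN : z.norm.natAbs ≤ N₀) (hz : Int.gcd z.re z.im = 1) (hpr0 : pr ≠ 0) :
    ofGauss (z / pr) ∈ primBox (radN N₀ j) := by
  set y := z / pr with hy
  have hzy : pr * y = z := EuclideanDomain.mul_div_cancel' hpr0 hdvd
  have hp0 : 0 < p := lt_of_lt_of_le (Nat.two_pow_pos j) hp
  -- norm bound
  have hyN : y.norm.natAbs ≤ N₀ / 2 ^ j := by
    have hmul : z.norm = pr.norm * y.norm := by rw [← hzy, Zsqrtd.norm_mul]
    have h1 : p * y.norm.natAbs = z.norm.natAbs := by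
      have : (z.norm.natAbs : ℤ) = p * (y.norm.natAbs : ℤ) := by
        rw [← norm_eq_natAbs, ← norm_eq_natAbs, hmul, hprn]
      exact_mod_cast this.symm
    have h2 : y.norm.natAbs ≤ N₀ / p := by
      rw [Nat.le_div_iff_mul_le hp0, mul_comm]; rw [h1]; exact hzN
    exact h2.trans (Nat.div_le_div_left hp (Nat.two_pow_pos j))
  obtain ⟨hr, hi⟩ := natAbs_re_le_sqrt hyN
  rw [mem_primBox]
  refine ⟨ofGauss_mem_intBox (hr.trans (Nat.le_succ _)) (hi.trans (Nat.le_succ _)), ?_⟩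
  exact isPrimVec_ofGauss_of_eq_mul hzy hz

/-- **The `w' = π̄ w` lie in `intBox (radM M₀ j)` and are nonzero** when `1 ≤ |w|² ≤ M₀`,
`|π|² = p < 2^{j+1}`. [cite: FriedlanderIwaniecAnnals1998, §5, proof of (5.22)] -/
theorem ofGauss_star_mul_mem {pr : GaussianInt} {p M₀ j m : ℕ} (hprn : pr.norm = p) (hp0 : 0 < p)
    (hp : p < 2 ^ (j + 1)) {w : ℤ × ℤ} (hw : w ∈ sqPairs m) (hm1 : 1 ≤ m) (hmM : m ≤ M₀) :
    ofGauss (star pr * toGauss w) ∈ (intBox (radM M₀ j)).filter (· ≠ 0) := by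
  have hwn : (toGauss w).norm = m := mem_sqPairs_iff_norm.mp hw
  have hnorm : (star pr * toGauss w).norm = p * m := by
    rw [Zsqrtd.norm_mul, Zsqrtd.norm_conj, hprn, hwn]
  rw [mem_filter]
  constructor
  · have hle : (star pr * toGauss w).norm.natAbs ≤ 2 ^ (j + 1) * M₀ := by
      have : ((star pr * toGauss w).norm.natAbs : ℤ) ≤ ((2 ^ (j + 1) * M₀ : ℕ) : ℤ) := by
        rw [← norm_eq_natAbs, hnorm]; push_cast
        have h1 : (p : ℤ) * m ≤ (2 ^ (j + 1) : ℤ) * m := by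
          have : (p : ℤ) ≤ 2 ^ (j + 1) := by exact_mod_cast hp.le
          exact mul_le_mul_of_nonneg_right this (by positivity)
        have h2 : (2 ^ (j + 1) : ℤ) * m ≤ 2 ^ (j + 1) * M₀ := by
          exact mul_le_mul_of_nonneg_left (by exact_mod_cast hmM) (by positivity)
        linarith
      exact_mod_cast this
    obtain ⟨hr, hi⟩ := natAbs_re_le_sqrt hle
    exact ofGauss_mem_intBox (hr.trans (Nat.le_succ _)) (hi.trans (Nat.le_succ _))
  · intro h0
    have : star pr * toGauss w = 0 := by
      have h := congrArg toGauss h0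
      rw [toGauss_ofGauss] at h
      rw [h]; rfl
    have hn0 : (star pr * toGauss w).norm = 0 := by rw [this, Zsqrtd.norm_zero]
    rw [hnorm] at hn0
    have : p * m = 0 := by exact_mod_cast hn0
    rcases Nat.mul_eq_zero.mp this with h | h <;> omega

/-! ### Sums over maps with bounded fibres -/

/-- `∑_{x ∈ S} g(f x) ≤ n ∑_{y ∈ T} g y` when `f(S) ⊆ T` and the fibres of `f` over `T` have at
most `n` elements. [folklore] -/
theorem sum_le_mul_sum_of_fibre_le {ι κ : Type*} [DecidableEq κ] (S : Finset ι) (T : Finset κ)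
    (f : ι → κ) (g : κ → ℕ) (n : ℕ) (hmaps : ∀ x ∈ S, f x ∈ T)
    (hfib : ∀ y ∈ T, #(S.filter fun x => f x = y) ≤ n) :
    ∑ x ∈ S, g (f x) ≤ n * ∑ y ∈ T, g y := by
  rw [← sum_fiberwise_of_maps_to hmaps (f := fun x => g (f x)), mul_sum]
  refine sum_le_sum fun y hy => ?_
  calc ∑ x ∈ S.filter (fun x => f x = y), g (f x) = ∑ x ∈ S.filter (fun x => f x = y), g y := by
        refine sum_congr rfl fun x hx => ?_; rw [(mem_filter.mp hx).2]
    _ = #(S.filter fun x => f x = y) * g y := by rw [sum_const, smul_eq_mul]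
    _ ≤ n * g y := Nat.mul_le_mul_right _ (hfib y hy)

/-- `∑_{x ∈ S} g(f x) ≤ ∑_{y ∈ T} g y` for `f` injective on `S` with `f(S) ⊆ T`. [folklore] -/
theorem sum_le_sum_of_injOn' {ι κ : Type*} [DecidableEq κ] (S : Finset ι) (T : Finset κ)
    (f : ι → κ) (g : κ → ℕ) (hinj : Set.InjOn f S) (hmaps : ∀ x ∈ S, f x ∈ T) :
    ∑ x ∈ S, g (f x) ≤ ∑ y ∈ T, g y := by
  calc ∑ x ∈ S, g (f x) = ∑ y ∈ S.image f, g y := (sum_image hinj).symm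
    _ ≤ ∑ y ∈ T, g y := sum_le_sum_of_subset_of_nonneg (image_subset_iff.mpr hmaps) fun _ _ _ => Nat.zero_le _

/-- `ω(n) ≤ log₂ n`. [folklore] -/
theorem card_primeFactors_le_log (n : ℕ) : #n.primeFactors ≤ Nat.log 2 n := by
  rcases Nat.eq_zero_or_pos n with rfl | hn
  · simp
  apply Nat.le_log_of_pow_le (by norm_num)
  calc 2 ^ #n.primeFactors ≤ ∏ p ∈ n.primeFactors, p :=
        pow_card_le_prod _ _ 2 fun p hp => (Nat.prime_of_mem_primeFactors hp).two_le
    _ ≤ n := Nat.le_of_dvd hn (Nat.prod_primeFactors_dvd n)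

/-! ### The main count -/

/-- The square `H(w') = (Σ_{y ∈ primBox R} 𝔷(Re w̄' y))²` summed over `w'` is `lemma51Count`. [folklore] -/
theorem lemma51Count_eq_sum_sq (RM RN : ℕ) : lemma51Count RM RN =
    ∑ w ∈ (intBox RM).filter (· ≠ 0), (∑ y ∈ primBox RN, fiZeta (reConj w y)) ^ 2 := by
  unfold lemma51Count
  refine sum_congr rfl fun w _ => ?_
  rw [sq, sum_mul_sum]

/-- `H_j(w') = (Σ_{y ∈ primBox (radN N₀ j)} 𝔷(Re w̄' y))²`. [folklore] -/
def sqSumH (N₀ j : ℕ) (w' : ℤ × ℤ) : ℕ := (∑ yy ∈ primBox (radN N₀ j), fiZeta (reConj w' yy)) ^ 2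

/-- `D(radM M₀ j, radN N₀ j) = Σ_{w'} H_j(w')`. [folklore] -/
theorem lemma51Count_eq_sum_sqSumH (M₀ N₀ j : ℕ) : lemma51Count (radM M₀ j) (radN N₀ j) =
    ∑ w ∈ (intBox (radM M₀ j)).filter (· ≠ 0), sqSumH N₀ j w := lemma51Count_eq_sum_sq _ _

/-- `ΣΣ_{a, b ∈ s} [P a ∧ P b] f a f b = (Σ_{a ∈ s, P a} f a)²`. [folklore] -/
theorem sum_sum_ite_and_eq_sq {α : Type*} (s : Finset α) (P : α → Prop) [DecidablePred P] (f : α → ℕ) :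
    ∑ a ∈ s, ∑ b ∈ s, (if P a ∧ P b then f a * f b else 0) = (∑ a ∈ s.filter P, f a) ^ 2 := by
  rw [sum_filter, sq, sum_mul_sum]
  refine sum_congr rfl fun a _ => sum_congr rfl fun b _ => ?_
  by_cases ha : P a <;> by_cases hb : P b <;> simp [ha, hb]

/-- **Step 3 of the count**: for a primary prime `π` of norm `p`, `2^j ≤ p`, the `z ∈ Z` divisible by
`π` reindex injectively as `y = z/π ∈ primBox (radN N₀ j)`, with `Re w̄ z = Re (π̄ w)‾ y`.
[cite: FriedlanderIwaniecAnnals1998, §5, proof of (5.22)] -/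
theorem sum_filter_dvd_le {Z : Finset GaussianInt} {N₀ : ℕ}
    (hZ : ∀ z ∈ Z, z.norm.natAbs ≤ N₀ ∧ Int.gcd z.re z.im = 1)
    {pr : GaussianInt} {p j : ℕ} (hprn : pr.norm = p) (hp : 2 ^ j ≤ p) (hpr0 : pr ≠ 0) (w : ℤ × ℤ)
    [DecidablePred fun z : GaussianInt => pr ∣ z] :
    ∑ z ∈ Z.filter (pr ∣ ·), fiZeta (star (toGauss w) * z).re ≤
      ∑ y ∈ primBox (radN N₀ j), fiZeta (reConj (ofGauss (star pr * toGauss w)) y) := by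
  have hrepr : ∀ z ∈ Z.filter (pr ∣ ·), fiZeta (star (toGauss w) * z).re =
      fiZeta (reConj (ofGauss (star pr * toGauss w)) (ofGauss (z / pr))) := by
    intro z hz
    have hd : pr ∣ z := (mem_filter.mp hz).2
    rw [reConj_ofGauss, ← star_mul_mul_eq, EuclideanDomain.mul_div_cancel' hpr0 hd]
  rw [sum_congr rfl hrepr]
  refine sum_le_sum_of_injOn' (Z.filter (pr ∣ ·)) (primBox (radN N₀ j)) (fun z => ofGauss (z / pr))
    (fun y => fiZeta (reConj (ofGauss (star pr * toGauss w)) y)) ?_ ?_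
  · intro z hz z' hz' h
    have hd : pr ∣ z := (mem_filter.mp hz).2
    have hd' : pr ∣ z' := (mem_filter.mp hz').2
    have h2 : z / pr = z' / pr := by
      have := congrArg toGauss h; rwa [toGauss_ofGauss, toGauss_ofGauss] at this
    rw [← EuclideanDomain.mul_div_cancel' hpr0 hd, ← EuclideanDomain.mul_div_cancel' hpr0 hd', h2]
  · intro z hz
    obtain ⟨hz1, hd⟩ := mem_filter.mp hz
    obtain ⟨hzN, hprim⟩ := hZ z hz1
    exact ofGauss_div_mem_primBox hprn hp hd hzN hprim hpr0

set_option maxHeartbeats 800000 in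
/-- **The fibres of `(π, w) ↦ π̄ w`** over a fixed `w'`, `π` primary of prime norm, have at most
`2 log₂(2^{j+1} M₀)` elements (`π` is one of the `≤ 2` primary elements of norm `p ∣ |w'|²`, and `w`
is determined). [cite: FriedlanderIwaniecAnnals1998, §5, proof of (5.22) ("for some P₁")] -/
theorem card_fibre_starMul_le (j : ℕ) (PPj : Finset ℕ) (hPP : ∀ p ∈ PPj, p.Prime ∧ p < 2 ^ (j + 1))
    (M₀ : ℕ) (w' : ℤ × ℤ) :
    #((PPj.sigma fun p => primaryNormEq p ×ˢ (Icc 1 M₀).biUnion sqPairs).filter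
        fun x => ofGauss (star x.2.1 * toGauss x.2.2) = w') ≤ 2 * Nat.log 2 (2 ^ (j + 1) * M₀) := by
  set F := (PPj.sigma fun p => primaryNormEq p ×ˢ (Icc 1 M₀).biUnion sqPairs).filter
        fun x => ofGauss (star x.2.1 * toGauss x.2.2) = w' with hF
  rcases F.eq_empty_or_nonempty with hE | ⟨x₀, hx₀⟩
  · rw [hE, card_empty]; exact Nat.zero_le _
  -- facts about members of the fibre
  have hmem : ∀ x ∈ F, (x.1.Prime ∧ x.1 < 2 ^ (j + 1)) ∧ x.2.1 ∈ primaryNormEq x.1 ∧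
      (∃ m, 1 ≤ m ∧ m ≤ M₀ ∧ x.2.2 ∈ sqPairs m) ∧ star x.2.1 * toGauss x.2.2 = toGauss w' := by
    intro x hx
    rw [hF, mem_filter, mem_sigma, mem_product, mem_biUnion] at hx
    obtain ⟨⟨hp, hpr, m, hm, hw⟩, heq⟩ := hx
    refine ⟨hPP _ hp, hpr, ⟨m, (mem_Icc.mp hm).1, (mem_Icc.mp hm).2, hw⟩, ?_⟩
    have := congrArg toGauss heq; rwa [toGauss_ofGauss] at this
  set n : ℕ := (toGauss w').norm.natAbs with hn
  have hnorm : ∀ x ∈ F, x.1 ∣ n ∧ n ≠ 0 ∧ n ≤ 2 ^ (j + 1) * M₀ := by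
    intro x hx
    obtain ⟨⟨hp, hplt⟩, hpr, ⟨m, hm1, hmM, hw⟩, heq⟩ := hmem x hx
    have hprn : (x.2.1).norm = x.1 := (mem_primaryNormEq.mp hpr).1
    have hN : (toGauss w').norm = x.1 * m := by
      rw [← heq, Zsqrtd.norm_mul, Zsqrtd.norm_conj, hprn, mem_sqPairs_iff_norm.mp hw]
    have hn' : n = x.1 * m := by
      have : (n : ℤ) = x.1 * m := by rw [hn, ← norm_eq_natAbs, hN]
      exact_mod_cast this
    refine ⟨⟨m, hn'⟩, by rw [hn']; exact Nat.mul_ne_zero hp.ne_zero (by omega), ?_⟩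
    rw [hn']
    exact Nat.mul_le_mul hplt.le hmM
  -- injection into (primeFactors n).sigma primaryNormEq
  have hinj : Set.InjOn (fun x : (Σ _ : ℕ, GaussianInt × (ℤ × ℤ)) => (⟨x.1, x.2.1⟩ : Σ _ : ℕ, GaussianInt)) F := by
    intro x hx x' hx' h
    simp only [Sigma.mk.injEq, heq_eq_eq] at h
    obtain ⟨h1, h2⟩ := h
    obtain ⟨-, hpr, -, heq⟩ := hmem x hx
    obtain ⟨-, -, -, heq'⟩ := hmem x' hx'
    have hpr0 : star x.2.1 ≠ 0 := by
      rw [Ne, star_eq_zero]; exact (mem_primaryNormEq.mp hpr).2.ne_zero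
    have hw : x.2.2 = x'.2.2 := by
      have : star x.2.1 * toGauss x.2.2 = star x.2.1 * toGauss x'.2.2 := by rw [heq, h2, heq']
      exact toGauss_injective (mul_left_cancel₀ hpr0 this)
    rcases x with ⟨p, pr, w⟩
    rcases x' with ⟨p', pr', w''⟩
    simp only at h1 h2 hw
    subst h1; subst h2; subst hw; rfl
  have hmaps : ∀ x ∈ F, (⟨x.1, x.2.1⟩ : Σ _ : ℕ, GaussianInt) ∈
      n.primeFactors.sigma fun p => primaryNormEq p := by
    intro x hx
    obtain ⟨⟨hp, -⟩, hpr, -, -⟩ := hmem x hx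
    obtain ⟨hdvd, hn0, -⟩ := hnorm x hx
    rw [mem_sigma]
    exact ⟨Nat.mem_primeFactors.mpr ⟨hp, hdvd, hn0⟩, hpr⟩
  obtain ⟨-, hn0, hnle⟩ := hnorm x₀ hx₀
  calc #F ≤ #(n.primeFactors.sigma fun p => primaryNormEq p) := card_le_card_of_injOn _ hmaps hinj
    _ = ∑ p ∈ n.primeFactors, #(primaryNormEq p) := card_sigma _ _
    _ ≤ ∑ p ∈ n.primeFactors, 2 :=
        sum_le_sum fun p hp => card_primaryNormEq_le_two (Nat.prime_of_mem_primeFactors hp)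
    _ = 2 * #n.primeFactors := by rw [sum_const, smul_eq_mul, mul_comm]
    _ ≤ 2 * Nat.log 2 n := Nat.mul_le_mul_left 2 (card_primeFactors_le_log n)
    _ ≤ 2 * Nat.log 2 (2 ^ (j + 1) * M₀) := Nat.mul_le_mul_left 2 (Nat.log_mono_right hnle)

set_option maxHeartbeats 1600000 in
/-- **The non-coprime pairs are controlled by Lemma 5.1 at the scales `(2^{j+1} M₀, N₀/2^j)`.**
For `Z` a finite set of nonzero primitive Gaussian integers with odd squarefree norms `≤ N₀` free of
prime factors `< P₀`:
`Σ_{1 ≤ |w|² ≤ M₀} ΣΣ_{z₁, z₂ ∈ Z, (z₁,z₂) ≠ 1} 𝔷(Re w̄ z₁) 𝔷(Re w̄ z₂)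
  ≤ Σ_{j = log₂ P₀}^{log₂ N₀} 2 log₂(2^{j+1} M₀) · D(radM M₀ j, radN N₀ j)`.
[cite: FriedlanderIwaniecAnnals1998, §5, proof of (5.22)] -/
theorem sum_noncoprime_le (Z : Finset GaussianInt) (N₀ M₀ P₀ : ℕ)
    (hZ : ∀ z ∈ Z, z ≠ 0 ∧ z.norm.natAbs ≤ N₀ ∧ z.norm.natAbs % 2 = 1 ∧
      Squarefree z.norm.natAbs ∧ Int.gcd z.re z.im = 1 ∧
      ∀ p ∈ z.norm.natAbs.primeFactors, P₀ ≤ p) :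
    ∑ w ∈ (Icc 1 M₀).biUnion sqPairs, ∑ z₁ ∈ Z, ∑ z₂ ∈ Z,
        (if GaussCoprime z₁ z₂ then 0 else
          fiZeta (star (toGauss w) * z₁).re * fiZeta (star (toGauss w) * z₂).re) ≤
      ∑ j ∈ Icc (Nat.log 2 P₀) (Nat.log 2 N₀), 2 * Nat.log 2 (2 ^ (j + 1) * M₀) *
        lemma51Count (radM M₀ j) (radN N₀ j) := by
  classical
  set W := (Icc 1 M₀).biUnion sqPairs with hW
  set PP := (Icc P₀ N₀).filter Nat.Prime with hPP
  set Sg := PP.sigma fun p => primaryNormEq p with hSg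
  set T : ℤ × ℤ → GaussianInt → GaussianInt → ℕ := fun w z₁ z₂ =>
    fiZeta (star (toGauss w) * z₁).re * fiZeta (star (toGauss w) * z₂).re with hT
  -- Step 1: termwise
  have hstep1 : ∀ w, ∀ zz ∈ Z ×ˢ Z,
      (if GaussCoprime zz.1 zz.2 then 0 else T w zz.1 zz.2) ≤
        ∑ y ∈ Sg, if y.2 ∣ zz.1 ∧ y.2 ∣ zz.2 then T w zz.1 zz.2 else 0 := by
    intro w zz hzz
    obtain ⟨hz₁, hz₂⟩ := mem_product.mp hzz
    split_ifs with hcop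
    · exact Nat.zero_le _
    · obtain ⟨hz0, hzN, hodd, hsq, hprim, hP⟩ := hZ zz.1 hz₁
      rw [gaussCoprime_iff] at hcop
      obtain ⟨p, hpp, hPp, hpn, pr, hpr, hd1, hd2⟩ := exists_primary_prime_dvd hz0 hodd hsq hP hcop
      have hy : (⟨p, pr⟩ : Σ _ : ℕ, GaussianInt) ∈ Sg := by
        rw [hSg, mem_sigma, hPP, mem_filter, mem_Icc]
        refine ⟨⟨⟨hPp, ?_⟩, hpp⟩, hpr⟩
        exact (Nat.le_of_dvd (Nat.pos_of_ne_zero (Int.natAbs_ne_zero.mpr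
          ((Zsqrtd.norm_eq_zero_iff (by norm_num) zz.1).not.mpr hz0))) hpn).trans hzN
      calc T w zz.1 zz.2 = (if (⟨p, pr⟩ : Σ _ : ℕ, GaussianInt).2 ∣ zz.1 ∧
            (⟨p, pr⟩ : Σ _ : ℕ, GaussianInt).2 ∣ zz.2 then T w zz.1 zz.2 else 0) := by
            rw [if_pos ⟨hd1, hd2⟩]
        _ ≤ ∑ y ∈ Sg, if y.2 ∣ zz.1 ∧ y.2 ∣ zz.2 then T w zz.1 zz.2 else 0 :=
            single_le_sum (f := fun y : (Σ _ : ℕ, GaussianInt) =>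
              if y.2 ∣ zz.1 ∧ y.2 ∣ zz.2 then T w zz.1 zz.2 else 0) (fun _ _ => Nat.zero_le _) hy
  -- Step 2: reorder and square
  have hstep2 : ∑ w ∈ W, ∑ zz ∈ Z ×ˢ Z,
      (∑ y ∈ Sg, if y.2 ∣ zz.1 ∧ y.2 ∣ zz.2 then T w zz.1 zz.2 else 0) =
      ∑ y ∈ Sg, ∑ w ∈ W, (∑ z ∈ Z.filter (y.2 ∣ ·), fiZeta (star (toGauss w) * z).re) ^ 2 := by
    have e1 : ∀ w ∈ W, ∑ zz ∈ Z ×ˢ Z, ∑ y ∈ Sg, (if y.2 ∣ zz.1 ∧ y.2 ∣ zz.2 then T w zz.1 zz.2 else 0) =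
        ∑ y ∈ Sg, ∑ zz ∈ Z ×ˢ Z, (if y.2 ∣ zz.1 ∧ y.2 ∣ zz.2 then T w zz.1 zz.2 else 0) :=
      fun w _ => Finset.sum_comm
    rw [sum_congr rfl e1, Finset.sum_comm]
    refine sum_congr rfl fun y _ => sum_congr rfl fun w _ => ?_
    rw [sum_product]
    simp only [hT]
    exact sum_sum_ite_and_eq_sq Z (fun z => y.2 ∣ z) (fun z => fiZeta (star (toGauss w) * z).re)
  -- Step 3: reindex the z and bound by H_j
  have hstep3 : ∀ y ∈ Sg, ∀ w ∈ W,
      (∑ z ∈ Z.filter (y.2 ∣ ·), fiZeta (star (toGauss w) * z).re) ^ 2 ≤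
        sqSumH N₀ (Nat.log 2 y.1) (ofGauss (star y.2 * toGauss w)) := by
    intro y hy w _
    rw [hSg, mem_sigma, hPP, mem_filter] at hy
    obtain ⟨⟨-, hpp⟩, hpr⟩ := hy
    obtain ⟨hprn, hprim⟩ := mem_primaryNormEq.mp hpr
    unfold sqSumH
    refine Nat.pow_le_pow_left ?_ 2
    exact sum_filter_dvd_le (fun z hz => ⟨(hZ z hz).2.1, (hZ z hz).2.2.2.2.1⟩) hprn
      (Nat.pow_log_le_self 2 hpp.ne_zero) hprim.ne_zero w
  -- Step 4: group the primes dyadically and apply the fibre bound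
  have hmapsJ : ∀ y ∈ Sg, Nat.log 2 y.1 ∈ Icc (Nat.log 2 P₀) (Nat.log 2 N₀) := by
    intro y hy
    rw [hSg, mem_sigma, hPP, mem_filter, mem_Icc] at hy
    rw [mem_Icc]
    exact ⟨Nat.log_mono_right hy.1.1.1, Nat.log_mono_right hy.1.1.2⟩
  have hblock : ∀ j ∈ Icc (Nat.log 2 P₀) (Nat.log 2 N₀),
      ∑ y ∈ Sg.filter (fun y => Nat.log 2 y.1 = j), ∑ w ∈ W, sqSumH N₀ j (ofGauss (star y.2 * toGauss w)) ≤
        2 * Nat.log 2 (2 ^ (j + 1) * M₀) * lemma51Count (radM M₀ j) (radN N₀ j) := by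
    intro j _
    set PPj := PP.filter (fun p => Nat.log 2 p = j) with hPPj
    have hPPj' : ∀ p ∈ PPj, p.Prime ∧ p < 2 ^ (j + 1) := by
      intro p hp
      rw [hPPj, mem_filter, hPP, mem_filter] at hp
      refine ⟨hp.1.2, ?_⟩
      rw [← hp.2]; exact Nat.lt_pow_succ_log_self (by norm_num) p
    have hset : Sg.filter (fun y => Nat.log 2 y.1 = j) = PPj.sigma fun p => primaryNormEq p := by
      ext y
      simp only [hSg, hPPj, mem_filter, mem_sigma]
      tauto
    rw [hset, sum_sigma]
    -- flatten to a sum over PPj.sigma (p ↦ primaryNormEq p × W)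
    have hflat : ∑ p ∈ PPj, ∑ pr ∈ primaryNormEq p, ∑ w ∈ W, sqSumH N₀ j (ofGauss (star pr * toGauss w)) =
        ∑ x ∈ PPj.sigma (fun p => primaryNormEq p ×ˢ W), sqSumH N₀ j (ofGauss (star x.2.1 * toGauss x.2.2)) := by
      rw [sum_sigma]
      refine sum_congr rfl fun p _ => ?_
      rw [sum_product]
    rw [hflat, lemma51Count_eq_sum_sqSumH]
    refine sum_le_mul_sum_of_fibre_le (PPj.sigma (fun p => primaryNormEq p ×ˢ W))
      ((intBox (radM M₀ j)).filter (· ≠ 0)) (fun x => ofGauss (star x.2.1 * toGauss x.2.2)) (sqSumH N₀ j)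
      (2 * Nat.log 2 (2 ^ (j + 1) * M₀)) ?_ ?_
    · intro x hx
      rw [mem_sigma, mem_product, hW, mem_biUnion] at hx
      obtain ⟨hp, hpr, m, hm, hw⟩ := hx
      obtain ⟨hpp, hplt⟩ := hPPj' _ hp
      exact ofGauss_star_mul_mem (mem_primaryNormEq.mp hpr).1 hpp.pos hplt hw (mem_Icc.mp hm).1
        (mem_Icc.mp hm).2
    · intro w' _
      exact card_fibre_starMul_le j PPj hPPj' M₀ w'
  -- assemble
  calc ∑ w ∈ W, ∑ z₁ ∈ Z, ∑ z₂ ∈ Z, (if GaussCoprime z₁ z₂ then 0 else T w z₁ z₂)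
      = ∑ w ∈ W, ∑ zz ∈ Z ×ˢ Z, (if GaussCoprime zz.1 zz.2 then 0 else T w zz.1 zz.2) := by
        refine sum_congr rfl fun w _ => ?_; rw [sum_product]
    _ ≤ ∑ w ∈ W, ∑ zz ∈ Z ×ˢ Z, ∑ y ∈ Sg, (if y.2 ∣ zz.1 ∧ y.2 ∣ zz.2 then T w zz.1 zz.2 else 0) :=
        sum_le_sum fun w _ => sum_le_sum fun zz hzz => hstep1 w zz hzz
    _ = ∑ y ∈ Sg, ∑ w ∈ W, (∑ z ∈ Z.filter (y.2 ∣ ·), fiZeta (star (toGauss w) * z).re) ^ 2 := hstep2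
    _ ≤ ∑ y ∈ Sg, ∑ w ∈ W, sqSumH N₀ (Nat.log 2 y.1) (ofGauss (star y.2 * toGauss w)) :=
        sum_le_sum fun y hy => sum_le_sum fun w hw => hstep3 y hy w hw
    _ = ∑ j ∈ Icc (Nat.log 2 P₀) (Nat.log 2 N₀), ∑ y ∈ Sg.filter (fun y => Nat.log 2 y.1 = j),
          ∑ w ∈ W, sqSumH N₀ j (ofGauss (star y.2 * toGauss w)) := by
        rw [← sum_fiberwise_of_maps_to hmapsJ]
        refine sum_congr rfl fun j _ => sum_congr rfl fun y hy => ?_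
        rw [(mem_filter.mp hy).2]
    _ ≤ ∑ j ∈ Icc (Nat.log 2 P₀) (Nat.log 2 N₀), 2 * Nat.log 2 (2 ^ (j + 1) * M₀) *
          lemma51Count (radM M₀ j) (radN N₀ j) := sum_le_sum hblock

end Literature.NumberTheory.Sieve.FriedlanderIwaniecPrimes

end
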